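import Summits.BirchSwinnertonDyer.BirchSwinnertonDyer.Theorems.AlignedTransportAtTwoMainConjectureTransportAlignedAtTwoDeltaPosFunctionalDepleted
import Summits.BirchSwinnertonDyer.BirchSwinnertonDyer.Theorems.AlignedTransportAtTwoMainConjectureTransportAlignedAtTwoOrdPlusLineOdd
import Literature.NumberTheory.EllipticCurves.ModularJacobianModPMultiplicityOne
import HarnessLib

/-!
# Crux C1 `MainConjectureTransportAlignedAtTwo` (stmt-BirchSwinnertonDyer-22296), line `birth`, plan «deltapos-galois» step (G4): the SIDE INPUTS of the
# carrier-agnostic Galois transport `…DeltaPosJacobianLevel.half_transport_of_abstract` for a depleted parametrisation map `[y] ↦ u_W(c'·y(g))` —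
# Hecke kernel (`T_q`, `q ∤ L`), `U_q`-kernel (`q ∣ L`) and non-vanishing on a half-class from `μ = 0` (width seat att-p3 g14; `--supports 22296`)

THEOREMS ONLY (no `def`, no named fact, no `sorry`). BSD is not proved by this; C1 is not closed by this.

`…DeltaPosJacobianLevel.half_transport_of_abstract` (this seat) takes abstract additive maps `Φᵢ : J0 L →+ Wᵢ(ℂ)` with three kinds of side hypotheses:
`hTᵢ` (`Φᵢ` kills the half-classes of `T_q^∨x − a_q(W₁)·x`, `q ∤ L`), `hUᵢ` (`Φᵢ` kills the half-classes of `U_q^∨x`, `q ∣ L`) and `hnzᵢ` (`Φᵢ` is non-zero on some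
half-class). For the map the future carrier (T1⁺/T2) will make `Γ_ℚ`-equivariant — `Φ [y] = u_W(c'·y(g))` with `g` the `S`-depleted eigenform at level `L` of the
newform `f` of `W` (`…StarLevel.exists_depleted_eigenform_of_dvd`: `T_q g = a_q(f) g` for `q ∉ S`, `U_ℓ g = 0` for `ℓ ∈ S`) and `c' = c·D_S` — these are:

* `apply_half_hecke_sub_eq_zero_of_eigen` — `T_q g = a·g`, `a − a' ∈ 2ℤ`, `c'·Λ_L(g) ⊆ Λ_E` ⟹ `Φ [(T_q^∨x − a'x)/2] = u_W(k·c'x(g)) = O`;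
* `apply_half_hecke_eq_zero_of_kill` — `U_q g = 0` ⟹ `Φ [U_q^∨x/2] = O`;
* `apply_half_ne_zero_of_odd` — (K2-depleted, att-p4 g13) an ODD depleted plus value at `x` forces `Φ [x/2] = u_W(c·D_S·x(g)/2) ∉ {O, T*}`, so `≠ O`;
* **`exists_apply_half_ne_zero`** — with the lead's `μ = 0` theorem `…OrdPlusLineOdd.exists_odd_depleted_periodFunctional` (ordinary at `2`, no rational
  `2`-torsion abscissa, even-branch lift): `∃ x ∈ Λ_L, Φ [x/2] ≠ O`.

References: Atkin–Lehner 1970 §3 [AtkinLehner1970]; Cremona 1997 §2.8, §2.10 [CremonaAlgorithms1997]; Mazur–Tate–Teitelbaum 1986 §I.10 [MazurTateTeitelbaum1986Invent].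
-/

noncomputable section

-- justification: the `Summit.BirchSwinnertonDyer.BirchSwinnertonDyer.…` path repeats a component (route-file convention)
set_option linter.dupNamespace false
set_option autoImplicit false

open scoped MatrixGroups ModularForm NumberField Classical
open CongruenceSubgroup Complex WeierstrassCurve IsDedekindDomain Polynomial Module
open Literature.NumberTheory.EllipticCurves Literature.NumberTheory.EllipticCurves.ModularForms
open Literature.NumberTheory.EllipticCurves.Greenberg1999
open Summit.BirchSwinnertonDyer.Rank1Residual.F1Sign2
open Summit.BirchSwinnertonDyer.BirchSwinnertonDyer.Theorems.AlignedTransportAtTwoDeltaPosFunctionalDepleted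
open Summit.BirchSwinnertonDyer.BirchSwinnertonDyer.Theorems.AlignedTransportAtTwoOrdPlusLineOdd

namespace Summit.BirchSwinnertonDyer.BirchSwinnertonDyer.Theorems.AlignedTransportAtTwoDeltaPosJacobianLevelHecke

section Hecke

variable {W : WeierstrassCurve ℚ} {N L : ℕ} [NeZero N] [NeZero L] (D : ModularParametrizationData W N)
  (g : CuspForm (Gamma0 L) 2) (c' : ℂ)
  (Φ : J0 L →+ (W.baseChange ℂ).toAffine.Point)

/-- **Hecke kernel on half-classes.** If `Φ [y] = u_W(c'·y(g))` for all `y`, `c'·x(g) ∈ Λ_E` for `x ∈ Λ_L`, `T_q g = a·g` and `a − a' = 2k`, then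
`Φ [(T_q^∨x − a'·x)/2] = O` for `x ∈ Λ_L` (the image is `u_W(k·c'x(g))`). [cite: CremonaAlgorithms1997, §2.10] [cite: AtkinLehner1970, §3] -/
theorem apply_half_hecke_sub_eq_zero_of_eigen
    (hΦ : ∀ y : Module.Dual ℂ (CuspForm (Gamma0 L) 2), Φ (Submodule.Quotient.mk y) = D.uniformize (c' * y g))
    (hmem : ∀ x ∈ periodHomology L, c' * x g ∈ D.L.lattice)
    {q : ℕ} (hq : q.Prime) {a a' k : ℤ}
    (hTg : (haveI : NeZero q := ⟨hq.ne_zero⟩; heckeT (Gamma0 L) 2 q g) = (a : ℂ) • g) (hk : a - a' = 2 * k)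
    {x : Module.Dual ℂ (CuspForm (Gamma0 L) 2)} (hx : x ∈ periodHomology L) :
    Φ (Submodule.Quotient.mk ((2 : ℂ)⁻¹ •
      ((haveI : NeZero q := ⟨hq.ne_zero⟩; heckeT (Gamma0 L) 2 q).dualMap x - (a' : ℂ) • x))) = 0 := by
  haveI : NeZero q := ⟨hq.ne_zero⟩
  rw [hΦ, ModularParametrizationData.uniformize_eq_zero_iff]
  have heval : ((2 : ℂ)⁻¹ • ((heckeT (Gamma0 L) 2 q).dualMap x - (a' : ℂ) • x)) g = (k : ℂ) * x g := by
    have hk' : (a : ℂ) - (a' : ℂ) = 2 * (k : ℂ) := by exact_mod_cast hk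
    rw [LinearMap.smul_apply, LinearMap.sub_apply, LinearMap.dualMap_apply, hTg, map_smul, LinearMap.smul_apply, smul_eq_mul,
      smul_eq_mul, smul_eq_mul, ← sub_mul, hk']
    field_simp
  rw [heval, show c' * ((k : ℂ) * x g) = (k : ℂ) * (c' * x g) by ring]
  have := D.L.lattice.smul_mem k (hmem x hx)
  rwa [zsmul_eq_mul] at this

/-- **`U_q`-kernel on half-classes.** If `Φ [y] = u_W(c'·y(g))` and `U_q g = 0` (`heckeT` at a prime `q ∣ L`), then `Φ [U_q^∨x/2] = O`.
[cite: AtkinLehner1970, §3] -/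
theorem apply_half_hecke_eq_zero_of_kill
    (hΦ : ∀ y : Module.Dual ℂ (CuspForm (Gamma0 L) 2), Φ (Submodule.Quotient.mk y) = D.uniformize (c' * y g))
    {q : ℕ} (hq : q.Prime) (hUg : (haveI : NeZero q := ⟨hq.ne_zero⟩; heckeT (Gamma0 L) 2 q g) = 0)
    (x : Module.Dual ℂ (CuspForm (Gamma0 L) 2)) :
    Φ (Submodule.Quotient.mk ((2 : ℂ)⁻¹ • (haveI : NeZero q := ⟨hq.ne_zero⟩; heckeT (Gamma0 L) 2 q).dualMap x)) = 0 := by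
  haveI : NeZero q := ⟨hq.ne_zero⟩
  rw [hΦ, LinearMap.smul_apply, LinearMap.dualMap_apply, hUg, map_zero, smul_zero, mul_zero, map_zero]

end Hecke

/-! ## Non-vanishing on a half-class from `μ = 0` -/

section NonVanishing

variable {W : WeierstrassCurve ℚ} [W.IsElliptic] {N L : ℕ} [NeZero N] [NeZero L] (D : ModularParametrizationData W N)

/-- **An odd depleted plus value forces a non-zero half-class image.** `D` a datum with `Δ(W) > 0`, ODD `c`, period unit `Ω(W) = u·Ω⁺_f`, `‖u‖₂ = 1`;
`g` the `S`-depleted form of `f = D.f` at a level `L` with `N·D_S ∣ L`; `Φ` any map with `Φ [x/2] = u_W(c·D_S·x(g)/2)` at the cycle `x ∈ Λ_L`; if the integer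
`(2D_S/Ω⁺_f)·re x(g) = n` is ODD then `Φ [x/2] ≠ O` ((K2) at the depleted level, att-p4 g13). [cite: CremonaAlgorithms1997, §2.8 (p. 26), §2.10] -/
theorem apply_half_ne_zero_of_odd (hΔ : 0 < W.Δ) (hc : Odd D.c) {u : ℚ} (hu : ‖(u : ℚ_[2])‖ = 1)
    (hΩ : W.realPeriodRat = u * plusPeriod D.f)
    (S : Finset ℕ) (hS : ∀ ℓ ∈ S, ℓ.Prime) (hNL : N * ∏ ℓ ∈ S, ℓ ^ 2 ∣ L)
    (g : CuspForm (Gamma0 L) 2) (hg : ∀ n : ℕ, cuspCoeff g n = if ∃ ℓ ∈ S, ℓ ∣ n then 0 else cuspCoeff D.f n)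
    (Φ : J0 L →+ (W.baseChange ℂ).toAffine.Point)
    {x : Module.Dual ℂ (CuspForm (Gamma0 L) 2)} (hx : x ∈ periodHomology L)
    (hΦx : Φ (Submodule.Quotient.mk ((2 : ℂ)⁻¹ • x)) = D.uniformize ((D.c : ℂ) * (((∏ ℓ ∈ S, ℓ ^ 2 : ℕ) : ℂ) * x g) / 2))
    {n : ℤ} (hn : (2 * ((∏ ℓ ∈ S, ℓ ^ 2 : ℕ) : ℝ) / plusPeriod D.f) * (x g).re = n) (hodd : Odd n) :
    Φ (Submodule.Quotient.mk ((2 : ℂ)⁻¹ • x)) ≠ 0 := by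
  intro h0
  have hiff := even_depletedPlusValue_iff_uniformize_half' D hΔ hc hu hΩ S hS L hNL g hg hx hn
  rw [← hΦx, h0] at hiff
  exact (Int.not_even_iff_odd.mpr hodd) (hiff.mpr (Or.inl rfl))

/-- **Non-vanishing on a half-class from `μ = 0`.** `W` globally minimal, good ORDINARY at `2`, no rational `2`-torsion abscissa, `Δ(W) > 0`; `D` a datum at the
conductor level with ODD `c` and the period unit; `l` a duplicate-free list of odd places, `S = natGenerator(l)`, `L` odd with `N_W·D_S ∣ L`, `g` the `S`-depleted
eigenform (`q`-expansion `hg`, `T_q g = a_q g` off `L`); `G` an even-branch lift (`μ(G) = 0` is the tree's theorem); `Φ` with `Φ [x/2] = u_W(c·D_S·x(g)/2)` on `Λ_L`.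
Then `Φ` is non-zero on some half-class (`…OrdPlusLineOdd.exists_odd_depleted_periodFunctional` + `apply_half_ne_zero_of_odd`).
[cite: MazurTateTeitelbaum1986Invent, §I.10 (10.1)] [cite: CremonaAlgorithms1997, §2.8 (2.8.8)] -/
theorem exists_apply_half_ne_zero [W.IsGloballyMinimal] [NeZero (W.conductorNorm ℤ)]
    (D₀ : ModularParametrizationData W (W.conductorNorm ℤ))
    (hord : IsOrdinaryAt W 2) (ht : ∀ x : ℚ, ¬ HasRationalTwoTorsionX W x) (hΔ : 0 < W.Δ) (hc : Odd D₀.c)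
    {u : ℚ} (hu : ‖(u : ℚ_[2])‖ = 1) (hΩ : W.realPeriodRat = u * plusPeriod D₀.f)
    (l : List (HeightOneSpectrum (𝓞 ℚ))) (hl : l.Nodup) (hl2 : ∀ v ∈ l, Rat.HeightOneSpectrum.natGenerator v ≠ 2)
    (hL : Odd L) (hNL : W.conductorNorm ℤ * ∏ ℓ ∈ (l.map Rat.HeightOneSpectrum.natGenerator).toFinset, ℓ ^ 2 ∣ L)
    (g : CuspForm (Gamma0 L) 2)
    (hg : ∀ n : ℕ, cuspCoeff g n =
      if ∃ ℓ ∈ (l.map Rat.HeightOneSpectrum.natGenerator).toFinset, ℓ ∣ n then 0 else cuspCoeff D₀.f n)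
    (hTg : ∀ (q : ℕ) (hq : q.Prime), ¬ q ∣ L → (haveI : NeZero q := ⟨hq.ne_zero⟩; heckeT (Gamma0 L) 2 q g) = ((W.LFunction q : ℤ) : ℂ) • g)
    {G : IwasawaAlgebra 2} (hG : IsEvenBranchLiftAtTwo W D₀.f G)
    (Φ : J0 L →+ (W.baseChange ℂ).toAffine.Point)
    (hΦ : ∀ x ∈ periodHomology L, Φ (Submodule.Quotient.mk ((2 : ℂ)⁻¹ • x)) =
      D₀.uniformize ((D₀.c : ℂ) * (((∏ ℓ ∈ (l.map Rat.HeightOneSpectrum.natGenerator).toFinset, ℓ ^ 2 : ℕ) : ℂ) * x g) / 2)) :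
    ∃ x ∈ periodHomology L, Φ (Submodule.Quotient.mk ((2 : ℂ)⁻¹ • x)) ≠ 0 := by
  set SS := (l.map Rat.HeightOneSpectrum.natGenerator).toFinset with hSS
  have hSSp : ∀ ℓ ∈ SS, ℓ.Prime := by
    intro ℓ hℓ; rw [hSS, List.mem_toFinset, List.mem_map] at hℓ
    obtain ⟨w, -, rfl⟩ := hℓ; exact Rat.HeightOneSpectrum.prime_natGenerator w
  obtain ⟨γ, z, hz, hzodd⟩ := exists_odd_depleted_periodFunctional W hord ht D₀.isNewformOf l hl hl2 L hL hNL g hg hTg hG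
  have hx : periodFunctional L γ ∈ periodHomology L := periodFunctional_mem_periodHomology L γ
  exact ⟨periodFunctional L γ, hx,
    apply_half_ne_zero_of_odd D₀ hΔ hc hu hΩ SS hSSp hNL g (fun n ↦ by rw [hg n]; split_ifs <;> rfl) Φ hx (hΦ _ hx) hz hzodd⟩

end NonVanishing

end Summit.BirchSwinnertonDyer.BirchSwinnertonDyer.Theorems.AlignedTransportAtTwoDeltaPosJacobianLevelHecke

end
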